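import HarnessLib
import Summits.Ventures.WeilGRH.UniformConductorFloorPrincipal
import Summits.Ventures.WeilGRH.OneCompleteMod13Even
import Summits.Ventures.WeilGRH.DualTrigMod13OddOne

/-!
# GRH arm (rh-explicit, venture WeilGRH): Weil positivity on `[−1, 1]` for EVERY non-principal Dirichlet character mod 13 — the complete level 13

Cell `rh-explicit`, WEIL TRACK — GRH ARM (seat weil-grh-1 gen12; pure assembly of two landed halves):
* EVEN non-principal characters mod 13: `OneCompleteMod13Even.weilPositivityOnChar_mod13_one_of_even` (weil-grh-2's checker-K χ-cells `KCellsMod13OneA/B` and the real island `CellMod13One`);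
* ODD characters mod 13: `weilPositivityOnChar_mod13_one_of_odd` (weil-grh-3's format-D-K lattice certificates, one per class, `DualTrigMod13OddOne`).
Since `13 ∈ F` (the principal character FAILS on `[−1, 1]` by weil-grh-1's flat-window witness `UniformFloor.not_weilPositivityOnChar_one_principal`),
the level is decided exactly: `WeilPositivityOnChar χ 1 ↔ χ ≠ 1`.  Pure assembly; RH/GRH-free; standard axioms.
-/

noncomputable section

namespace Summit.Ventures.WeilGRH.OneCompleteMod13All
open Literature.NumberTheory.LFunctions

/-- ★★ **Every non-principal Dirichlet character mod 13 satisfies Weil positivity on `[−1, 1]`.**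
[cite: Weil1952FormulesExplicites, (11) pp. 261–262 and the «lemme» p. 262] -/
theorem weilPositivityOnChar_mod13_one (χ : DirichletCharacter ℂ 13) (hχ : χ ≠ 1) : WeilPositivityOnChar χ 1 := by
  rcases χ.even_or_odd with he | ho
  · exact OneCompleteMod13Even.weilPositivityOnChar_mod13_one_of_even χ hχ he
  · exact weilPositivityOnChar_mod13_one_of_odd χ ho

/-- ★★ **At level 13 EXACTLY the principal character fails Weil positivity on `[−1, 1]`**: for every Dirichlet character `χ` mod 13,
`WeilPositivityOnChar χ 1 ↔ χ ≠ 1`. [cite: Weil1952FormulesExplicites, (11) pp. 261–262 and the «lemme» p. 262] -/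
theorem weilPositivityOnChar_one_iff_ne_one_mod13 (χ : DirichletCharacter ℂ 13) : WeilPositivityOnChar χ 1 ↔ χ ≠ 1 :=
  ⟨fun h h1 ↦ UniformFloor.not_weilPositivityOnChar_one_principal (q := 13) (by decide) (h1 ▸ h), weilPositivityOnChar_mod13_one χ⟩

/-- Every non-principal character mod 13 is Weil-positive on every window `[−t, t]`, `t ≤ 1`. [folklore] -/
theorem weilPositivityOnChar_of_le_one_mod13 (χ : DirichletCharacter ℂ 13) (hχ : χ ≠ 1) {t : ℝ} (ht : t ≤ 1) :
    WeilPositivityOnChar χ t := fun g hg hsupp ↦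
  weilPositivityOnChar_mod13_one χ hχ g hg (hsupp.trans (Set.Icc_subset_Icc (by linarith) ht))

end Summit.Ventures.WeilGRH.OneCompleteMod13All

end
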